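import Summits.QuantumFields.YangMills.Theorems.AlphaInputsT3ACv3StepTrivPins
import Summits.QuantumFields.YangMills.Theorems.AlphaInputsT3ACv3StepLow
import HarnessLib

/-!
# `AlphaInputsT3ACv3StepLowTrivPins` — THE LOWER STEP ROW `PinnedStep.Fibre57LowOnAC` (R3D-02χ, print's (37)∕(57) at the trivial history with a
# validity family `lo` on both sides) AT EVERY LEVEL `k`, `G = SU(2)`, FROM THE SAME (55) DATA PINS AS THE UPPER ROW — the `k ≥ 1` twin of the lower
# half of `Balaban3D.Proofs.FibreZeroSU2.fibre_pair_zero_of_pins` (cell ym3-torus; desk pub/ym-inputs INPUT-LIST v7 §3 I-12; seat ym-inputs-p08 g2;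
# helper `--supports stmt-QuantumFields-20520`; companion of `…AlphaInputsT3ACv3StepTrivPins`)

WHY.  The α-package carries, next to the upper residual row `PinnedStep.Fibre55WinAC` (supplied at the trivial history modulo pins by
`PinnedStepTrivPins.fibre55WinAC_triv_of_pins`), the LOWER row `PinnedStep.Fibre57LowOnAC 𝔎 X 𝔖 lo k` (`…AlphaInputsT3ACv3StepLow` §2):
`𝟙[lo (k+1)](V)·exp[−mainT_{k+1}(triv,V) − E_k + (log σ₀ + d log g_k)·⋆B(triv) + logZU(triv,V) + Pold(triv,V) − R_k + logFl(triv,V)]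
 ≤ᵐ T_k[𝟙[lo k]·exp(−mainT_k(triv,·) + 𝒫_k(triv,·) − E_k − R_k)](V)` — [Balaban1985UV3] (37) p.265 «ρ₁(V) ≥ χ₁ exp[…]» and p.272 L32–33 «The lower
bound is proved in the same way, with all simplifications coming from the fact that Ω_{k+1} = T_η», generic in the validity family `lo` (displayed instances
`PinnedStep.chiMinAC` ∕ `loPrintAC` = print's χ on the minimiser).  THIS FILE proves it for EVERY `k` (`k + 1 ≤ m + K`), for the lane's AC tower over any
`S`, `𝔎`, `X` (axial averaging at level `k`), `𝔖` and ANY `lo`, from: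
* the SAME transport data as the upper file (background section `U₁` axial on the forest with `Ū₁(V) = V` and the displayed covariance
  `X.Uk k V = ukAll X.Uk k (U₁ V)`; quadratic datum `q_V`, `Z_q(V) > 0`; data rows `hU`∕`hPm`∕`hPb` at `(k, triv)`; the displayed gauge invariance `hinv`
  of the (41)_k integrand at `triv`) and the SAME (55) PINS `hσ`∕`hdg`∕`hZU`∕`hFl` — `hFl` BYTE-IDENTICAL to the upper file's (the fluctuation integrand
  `Ψ_{k,V}` carries the small-field factor `χB_k(triv′)`), so ONE `𝔖_Bal` serves BOTH rows;
* `lo k` measurable and gauge-invariant (`hlom`, `hloinv`; for `chiMinAC`: the minimiser's covariance);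
* the two k = 0-shaped rows of the lower half of `fibre_pair_zero_of_pins`: `hdom : χB_k(triv′)(U) ≠ 0 ⇒ U ∈ lo k` (the small-field window of (49)
  lies inside the validity family — [Balaban1985Variational] Thm 1 (8) «small plaquettes ⇒ regular minimiser», the r1-type row, displayed; at `k = 0`
  with `lo 0` = the (4)-window: `PinnedStep.plaqSmall_subset_chiMinAC_zero`) and `hpos : V ∈ lo (k+1) ⇒ 0 < ∫Ψ_{k,V} dμ_V` (the `hreg` of the k = 0 file,
  [7] Thm 1 regularity ⇒ the fluctuation integrand is positive near `A′ = 0`; displayed).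
Road (`fibre57LowOnAC_of_pins`): the transport identity and the computed fluctuation integral of the upper file, GENERALISED to an arbitrary measurable
gauge-invariant cut-off `φ ∈ [0, 1]` and an arbitrary constant tail (`transport_triv_ae_eq_fluct_gen`, `fluct_integral_triv_eq_gen` — same proofs); on
`{V ∈ lo (k+1)}`: `e^{log ∫Ψ} = ∫Ψ` (`hpos`) and `∫_W χB(U′U₁)·e^{…} ≤ ∫_W 𝟙[lo k](U′U₁)·e^{…}` (`hdom`, monotonicity of a finite Haar integral of bounded
measurable integrands); off it both sides are `0 ≤ ∫(≥ 0)`.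

HONEST SCOPE.  [folklore] measure theory over the lane's kernel theorems; nothing of [Balaban1985UV3] asserted; the row is proved MODULO THE PINS and the
two displayed rows `hdom`∕`hpos` — NO (O″χ) row is discharged at free data (RULING g26-№2); count-neutral; no summit ∕ sub-problem statement proved
(rung R3 bookkeeping; not T⁴, not Clay; the Yang–Mills mass gap is NOT proved).  Def-free; L-floor: none.
WHICH AVERAGING (located, applies equally to the upper file and to the k = 0 foothold).  `hav : (X.av k).avg = axialAvg` is the LANE's axial (decimation)
averaging, for which the gauge-fixed fibre is a product Haar integral (`AxialFibre`, `AxialGaugeShift`, `FluctChartSU2`).  The T³ record's AC inputs `XT3` pin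
`BlockAveraging.blockAvg ℰp` in the standing range (`AlphaInputsT3AC.avT3_of_le`), print's genuine block averaging of [Balaban1985Averaging] (10)∕(15), whose
fibre integral is resolved in print by the linearised constraint `δ(QA)δ_{Ax}(A)` of [Balaban1985UV3] (13)–(18) p.259–260 ∕ (51) p.268 — a `blockAvg` twin of
`AxialGaugeShift.rnTransport_ae_eq_integral_fluct` + `FluctGaussSU2.fluct_integral_eq_gauss` that is NOT in the tree.  At the record these rows (and the k = 0
ones) therefore fire only through that twin; with it, §1 here goes through verbatim (the only use of `hav` is `rnTransport_ae_eq_integral_fluct`).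
References: T. Bałaban, CMP 102 (1985) 255–275 [Balaban1985UV3] ((37) p.265, (47) p.267, (49)–(55) pp.268–269, (57)–(58) p.270, p.272 L32–33);
CMP 102 (1985) 277–309 [Balaban1985Variational] (Thm 1 (8) p.279).
-/

set_option autoImplicit false

noncomputable section

namespace Summit.QuantumFields.YangMills.Theorems.PinnedStepTrivPins

open MeasureTheory Metric Literature.MathematicalPhysics.QuantumFieldTheory.Balaban1983to89
open Literature.MathematicalPhysics.QuantumFieldTheory.Balaban1983to89.AveragingRT (axialAvg rnTransport)
open Literature.MathematicalPhysics.QuantumFieldTheory.Balaban1983to89.GaugeField (GaugeInvariant gaugeAct)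
open Literature.MathematicalPhysics.QuantumFieldTheory.Balaban1983to89.T4HaarSU2ExpChart (expWeight)
open Literature.MathematicalPhysics.QuantumFieldTheory.Balaban1985CMP102 Literature.MathematicalPhysics.QuantumFieldTheory.Balaban1985CMP102.Setting
open Summit.QuantumFields.Balaban3D.Carriers
open Summit.QuantumFields.Balaban3D.Proofs.Inputs (LaneConsts)
open Summit.QuantumFields.Balaban3D.Proofs.ScalesArithmetic (gk_pos)
open Summit.QuantumFields.Balaban3D.Proofs.TowerAC Summit.QuantumFields.Balaban3D.Proofs.StandardAC Summit.QuantumFields.Balaban3D.Proofs.InputsAC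
open Summit.QuantumFields.Balaban3D.Proofs.Bound55Masses (chiB chiB_nonneg chiB_le_one measurable_chiB)
open Summit.QuantumFields.Balaban3D.Proofs.ProductChartSU2 (SU2)
open Summit.QuantumFields.Balaban3D.Proofs.AxialGauge (measurable_crossParam)
open Summit.QuantumFields.Balaban3D.Proofs.AxialGaugeFix (forest axGlue)
open Summit.QuantumFields.Balaban3D.Proofs.AxialGaugeShift (fluct rnTransport_ae_eq_integral_fluct)
open Summit.QuantumFields.Balaban3D.Proofs.FluctGaussSU2
open Summit.QuantumFields.Balaban3D.Proofs.ChartScalingSU2 (E3)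
open Summit.QuantumFields.Balaban3D.Proofs.GaussianNormalization (partZ normalized)
open Summit.QuantumFields.Balaban3D.Proofs (Bound55Std.measurable_actionEta)
open Summit.QuantumFields.YangMills.Theorems.PinnedStep (Fibre57LowOnAC)

variable {L : ℕ} (𝔎 : LaneConsts L) {S : Scales L}
  {Val : Type} [NormedAddCommGroup Val] [NormedSpace ℂ Val]
  (X : ExternalInputsAC S SU2) (𝔖 : ∀ k, StepSeries S SU2 Val (nblkOf S 𝔎.carrier k) k)

/-! ## §1 The transport identity and the fluctuation integral for a general cut-off and constant tail -/

/-- **(48) + (13) AT THE TRIVIAL HISTORY, GENERAL CUT-OFF**: for a measurable gauge-invariant `φ ∈ [0,1]` and any constant `c`,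
`T_k[φ·e^{−mainT_k(triv) + 𝒫_k(triv) + c}](V) = ∫ (φ·e^{…})(fluct W · U₁(V)) dW` for dV-a.e. `V` (`AxialGaugeShift.rnTransport_ae_eq_integral_fluct`).
[cite: Balaban1985UV3, (13) p.259 + (48)–(50) p.268] -/
theorem transport_triv_ae_eq_fluct_gen (k : ℕ) [DecidableEq (PBond S.P k)] (hk : k + 1 ≤ S.P.m + S.P.K)
    (hav : (X.av k).avg = axialAvg)
    (U₁ : GaugeField S.P (k + 1) SU2 → GaugeField S.P k SU2) (hax : ∀ V, ∀ b ∈ forest S.P k, U₁ V b = 1)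
    (hfib : ∀ V, axialAvg (U₁ V) = V)
    (hU : Measurable (X.UkH k (Hist.triv S.P k))) (hPm : Measurable ((inputOfAC 𝔎 X 𝔖).Pint k (Hist.triv S.P k)))
    (cP : ℝ) (hPb : ∀ U, (inputOfAC 𝔎 X 𝔖).Pint k (Hist.triv S.P k) U ≤ cP)
    (hinv : GaugeInvariant (fun U : GaugeField S.P k SU2 =>
      Real.exp (-((towerOfAC 𝔎 X 𝔖).mainT k (Hist.triv S.P k) U) + (towerOfAC 𝔎 X 𝔖).Pint k (Hist.triv S.P k) U)))
    (φ : GaugeField S.P k SU2 → ℝ) (hφm : Measurable φ) (hφ0 : ∀ U, 0 ≤ φ U) (hφ1 : ∀ U, φ U ≤ 1) (hφinv : GaugeInvariant φ) (c : ℝ) :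
    rnTransport (X.av k).avg (fun U => φ U *
          Real.exp (-((towerOfAC 𝔎 X 𝔖).mainT k (Hist.triv S.P k) U) + (towerOfAC 𝔎 X 𝔖).Pint k (Hist.triv S.P k) U + c))
      =ᵐ[fieldMeasure S.P (k + 1) SU2] fun V =>
        ∫ W, φ (fun b => fluct W b * U₁ V b) *
          Real.exp (-((towerOfAC 𝔎 X 𝔖).mainT k (Hist.triv S.P k) (fun b => fluct W b * U₁ V b))
            + (towerOfAC 𝔎 X 𝔖).Pint k (Hist.triv S.P k) (fun b => fluct W b * U₁ V b) + c) ∂(fieldMeasure S.P k SU2) := by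
  set ρ : Density S.P k SU2 := fun U => φ U *
    Real.exp (-((towerOfAC 𝔎 X 𝔖).mainT k (Hist.triv S.P k) U) + (towerOfAC 𝔎 X 𝔖).Pint k (Hist.triv S.P k) U + c) with hρ
  have hmain : ∀ U, (towerOfAC 𝔎 X 𝔖).mainT k (Hist.triv S.P k) U = (S.gk k)⁻¹ ^ 2 * S.actionEta k (X.UkH k (Hist.triv S.P k) U) := fun _ => rfl
  have hPt : ∀ U, (towerOfAC 𝔎 X 𝔖).Pint k (Hist.triv S.P k) U = (inputOfAC 𝔎 X 𝔖).Pint k (Hist.triv S.P k) U := fun _ => rfl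
  have hexpm : Measurable fun U : GaugeField S.P k SU2 =>
      -((towerOfAC 𝔎 X 𝔖).mainT k (Hist.triv S.P k) U) + (towerOfAC 𝔎 X 𝔖).Pint k (Hist.triv S.P k) U + c := by
    simp_rw [hmain, hPt]
    exact ((measurable_const.mul ((Bound55Std.measurable_actionEta (S := S) k).comp hU)).neg.add hPm).add measurable_const
  have hρm : Measurable ρ := hφm.mul (Real.measurable_exp.comp hexpm)
  have hρb : ∀ U, |ρ U| ≤ Real.exp (cP + c) := fun U => by
    have h0 := mainT_nonneg 𝔎 X 𝔖 k (Hist.triv S.P k) U; have h1 := hPb U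
    have hle : -((towerOfAC 𝔎 X 𝔖).mainT k (Hist.triv S.P k) U) + (towerOfAC 𝔎 X 𝔖).Pint k (Hist.triv S.P k) U + c ≤ cP + c := by
      rw [hPt]; linarith
    rw [hρ]; dsimp only; rw [abs_mul, Real.abs_exp, abs_of_nonneg (hφ0 U)]
    calc φ U * Real.exp _ ≤ 1 * Real.exp (cP + c) :=
          mul_le_mul (hφ1 U) (Real.exp_le_exp.mpr hle) (Real.exp_pos _).le zero_le_one
      _ = Real.exp (cP + c) := one_mul _
  have hρi : Integrable ρ (fieldMeasure S.P k SU2) := AveragingRT.integrable_of_abs_le hρm _ hρb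
  have hρinv : GaugeInvariant ρ := fun u U => by
    have h1 : φ (gaugeAct u U) = φ U := hφinv u U
    have h2 := hinv u U; dsimp only at h2
    have e : ∀ W : GaugeField S.P k SU2, ρ W = φ W * (Real.exp (-((towerOfAC 𝔎 X 𝔖).mainT k (Hist.triv S.P k) W)
        + (towerOfAC 𝔎 X 𝔖).Pint k (Hist.triv S.P k) W) * Real.exp c) := fun W => by
      rw [hρ]; dsimp only; rw [← Real.exp_add]
    rw [e, e, h1, h2]
  rw [hav]; exact rnTransport_ae_eq_integral_fluct hk ρ hρi hρm hρinv U₁ hax hfib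

/-- **THE GAUGE-FIXED FLUCTUATION INTEGRAL AT LEVEL `k`, GENERAL CUT-OFF AND CONSTANT TAIL** ((50)–(55) for the lane's axial averaging, `G = SU(2)`,
trivial history): `∫ (φ·e^{−mainT_k + 𝒫_k + c})(fluct W · U₁(V)) dW = e^{−mainT_{k+1}(triv′,V) + c + 𝒫old(triv′,V)} · σ₀^N · g_k^{3N} · Z_q(V) · ∫ Ψ^φ_{k,V} dμ_V`
with `Ψ^φ` print's (55) fluctuation integrand with the cut-off `φ` and (58)'s recentring of the old terms. [cite: Balaban1985UV3, (50)–(55) pp.268–269 + (58) p.270] -/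
theorem fluct_integral_triv_eq_gen (k : ℕ) [DecidableEq (PBond S.P k)] (hk : k + 1 ≤ S.P.m + S.P.K)
    (U₁ : GaugeField S.P (k + 1) SU2 → GaugeField S.P k SU2) (hbg : ∀ V, X.Uk k V = ukAll X.Uk k (U₁ V))
    (q : GaugeField S.P (k + 1) SU2 → (Free S.P k → E3) → ℝ)
    (hU : Measurable (X.UkH k (Hist.triv S.P k))) (hPm : Measurable ((inputOfAC 𝔎 X 𝔖).Pint k (Hist.triv S.P k)))
    (cP : ℝ) (hPb : ∀ U, (inputOfAC 𝔎 X 𝔖).Pint k (Hist.triv S.P k) U ≤ cP)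
    (φ : GaugeField S.P k SU2 → ℝ) (hφm : Measurable φ) (hφ0 : ∀ U, 0 ≤ φ U) (hφ1 : ∀ U, φ U ≤ 1) (c : ℝ)
    (V : GaugeField S.P (k + 1) SU2) (hqm : Measurable (q V)) (hZ : 0 < partZ (volume : Measure (Free S.P k → E3)) (q V)) :
    ∫ W, φ (fun b => fluct W b * U₁ V b) *
          Real.exp (-((towerOfAC 𝔎 X 𝔖).mainT k (Hist.triv S.P k) (fun b => fluct W b * U₁ V b))
            + (towerOfAC 𝔎 X 𝔖).Pint k (Hist.triv S.P k) (fun b => fluct W b * U₁ V b) + c) ∂(fieldMeasure S.P k SU2)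
      = Real.exp (-((towerOfAC 𝔎 X 𝔖).mainT (k + 1) (Hist.triv S.P (k + 1)) V) + c + (piecesAC 𝔎 X 𝔖 k).Pold (Hist.triv S.P (k + 1)) V) *
        (sigma0 ^ Fintype.card (Free S.P k) * S.gk k ^ (3 * Fintype.card (Free S.P k)) *
          partZ (volume : Measure (Free S.P k → E3)) (q V) *
          ∫ A, (Set.univ.pi fun _ : Free S.P k => ball (0 : E3) Real.pi).indicator (fun _ => (1 : ℝ)) (S.gk k • A) *
              φ (fieldAt U₁ (S.gk k) V A) * (∏ i, expWeight ((S.gk k • A) i) / sigma0) *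
              Real.exp (-((towerOfAC 𝔎 X 𝔖).mainT k (Hist.triv S.P k) (fieldAt U₁ (S.gk k) V A)
                  - (towerOfAC 𝔎 X 𝔖).mainT (k + 1) (Hist.triv S.P (k + 1)) V)
                + ((towerOfAC 𝔎 X 𝔖).Pint k (Hist.triv S.P k) (fieldAt U₁ (S.gk k) V A) - (piecesAC 𝔎 X 𝔖 k).Pold (Hist.triv S.P (k + 1)) V)
                + q V A)
            ∂(normalized (volume : Measure (Free S.P k → E3)) (q V))) := by
  set mT : GaugeField S.P k SU2 → ℝ := fun U => (towerOfAC 𝔎 X 𝔖).mainT k (Hist.triv S.P k) U with hmT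
  set Pt : GaugeField S.P k SU2 → ℝ := fun U => (towerOfAC 𝔎 X 𝔖).Pint k (Hist.triv S.P k) U with hPt
  set m₁ : ℝ := (towerOfAC 𝔎 X 𝔖).mainT (k + 1) (Hist.triv S.P (k + 1)) V with hm₁
  set Po : ℝ := (piecesAC 𝔎 X 𝔖 k).Pold (Hist.triv S.P (k + 1)) V with hPo
  set Sk : GaugeField S.P k SU2 → ℝ := fun U => mT U + (cP - Pt U) with hSk
  have hmain : ∀ U, mT U = (S.gk k)⁻¹ ^ 2 * S.actionEta k (X.UkH k (Hist.triv S.P k) U) := fun _ => rfl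
  have hSm : Measurable Sk := by
    have hPm' : Measurable Pt := hPm
    simp_rw [hSk, hmain]
    exact (measurable_const.mul ((Bound55Std.measurable_actionEta (S := S) k).comp hU)).add (measurable_const.sub hPm')
  have hPt' : ∀ U, Pt U = (inputOfAC 𝔎 X 𝔖).Pint k (Hist.triv S.P k) U := fun _ => rfl
  have hS0 : ∀ U, 0 ≤ Sk U := fun U => by
    have h0 : 0 ≤ mT U := mainT_nonneg 𝔎 X 𝔖 k (Hist.triv S.P k) U
    have h1 : Pt U ≤ cP := by rw [hPt']; exact hPb U
    show 0 ≤ mT U + (cP - Pt U); linarith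
  have hφb : ∀ U, |φ U| ≤ 1 := fun U => by rw [abs_of_nonneg (hφ0 U)]; exact hφ1 U
  have hg : 0 < S.gk k := gk_pos S k
  have hSU₁ : Sk (U₁ V) = m₁ + (cP - Pt (U₁ V)) := by
    show mT (U₁ V) + (cP - Pt (U₁ V)) = m₁ + (cP - Pt (U₁ V))
    rw [hmT, hm₁]; simp only
    rw [mainT_triv_succ_eq 𝔎 X 𝔖 k U₁ hbg V]
  have hpt : ∀ U : GaugeField S.P k SU2, φ U * Real.exp (-(mT U) + Pt U + c) = φ U * Real.exp (-(Sk U)) * Real.exp (cP + c) := fun U => by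
    rw [mul_assoc, ← Real.exp_add]; congr 2; rw [hSk]; simp only; ring
  simp_rw [show ∀ W : GaugeField S.P k SU2, (towerOfAC 𝔎 X 𝔖).mainT k (Hist.triv S.P k) (fun b => fluct W b * U₁ V b)
      = mT (fun b => fluct W b * U₁ V b) from fun _ => rfl,
    show ∀ W : GaugeField S.P k SU2, (towerOfAC 𝔎 X 𝔖).Pint k (Hist.triv S.P k) (fun b => fluct W b * U₁ V b)
      = Pt (fun b => fluct W b * U₁ V b) from fun _ => rfl,
    show ∀ A, (towerOfAC 𝔎 X 𝔖).mainT k (Hist.triv S.P k) (fieldAt U₁ (S.gk k) V A) = mT (fieldAt U₁ (S.gk k) V A) from fun _ => rfl,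
    show ∀ A, (towerOfAC 𝔎 X 𝔖).Pint k (Hist.triv S.P k) (fieldAt U₁ (S.gk k) V A) = Pt (fieldAt U₁ (S.gk k) V A) from fun _ => rfl]
  simp_rw [hpt]
  rw [integral_mul_const, fluct_integral_eq_gauss hk Sk φ hSm hS0 hφm hφb q U₁ hg V hqm hZ, hSU₁]
  have hΨ : ∀ A : Free S.P k → E3, fluctIntegrand Sk φ q U₁ (S.gk k) V A * Real.exp (Pt (U₁ V) - Po)
      = (Set.univ.pi fun _ : Free S.P k => ball (0 : E3) Real.pi).indicator (fun _ => (1 : ℝ)) (S.gk k • A) *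
          φ (fieldAt U₁ (S.gk k) V A) * (∏ i, expWeight ((S.gk k • A) i) / sigma0) *
          Real.exp (-(mT (fieldAt U₁ (S.gk k) V A) - m₁) + (Pt (fieldAt U₁ (S.gk k) V A) - Po) + q V A) := fun A => by
    unfold fluctIntegrand
    rw [hSU₁, mul_assoc _ (Real.exp _) (Real.exp _), ← Real.exp_add]
    congr 2
    show -(mT (fieldAt U₁ (S.gk k) V A) + (cP - Pt (fieldAt U₁ (S.gk k) V A)) - (m₁ + (cP - Pt (U₁ V)))) + q V A
        + (Pt (U₁ V) - Po) = _
    ring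
  have hI : ∫ A, fluctIntegrand Sk φ q U₁ (S.gk k) V A ∂(normalized (volume : Measure (Free S.P k → E3)) (q V))
      = Real.exp (Po - Pt (U₁ V)) *
        ∫ A, (Set.univ.pi fun _ : Free S.P k => ball (0 : E3) Real.pi).indicator (fun _ => (1 : ℝ)) (S.gk k • A) *
            φ (fieldAt U₁ (S.gk k) V A) * (∏ i, expWeight ((S.gk k • A) i) / sigma0) *
            Real.exp (-(mT (fieldAt U₁ (S.gk k) V A) - m₁) + (Pt (fieldAt U₁ (S.gk k) V A) - Po) + q V A)
          ∂(normalized (volume : Measure (Free S.P k → E3)) (q V)) := by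
    rw [← integral_const_mul]
    refine integral_congr_ae (Filter.Eventually.of_forall fun A => ?_)
    dsimp only
    rw [← hΨ A, mul_comm (Real.exp _), mul_assoc, ← Real.exp_add, show Pt (U₁ V) - Po + (Po - Pt (U₁ V)) = 0 by ring,
      Real.exp_zero, mul_one]
  rw [hI]
  have h3 : Real.exp (-m₁ + c + Po) = Real.exp (-(m₁ + (cP - Pt (U₁ V)))) * Real.exp (Po - Pt (U₁ V)) * Real.exp (cP + c) := by
    rw [← Real.exp_add, ← Real.exp_add]; congr 1; ring
  rw [h3]; ring

/-- Real arithmetic of the (57) exponent: for `σ, g, Z, I > 0`, `e^{E + (log σ + 3 log g)N + log Z + log I} = e^{E}·(σ^N g^{3N} Z·I)`. [folklore] -/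
theorem exp_mul_eq_exp_log_pins (E σ g Z I : ℝ) (N : ℕ) (hσ : 0 < σ) (hg : 0 < g) (hZ : 0 < Z) (hI : 0 < I) :
    Real.exp (E + ((Real.log σ + 3 * Real.log g) * N + Real.log Z + Real.log I)) = Real.exp E * (σ ^ N * g ^ (3 * N) * Z * I) := by
  have e1 : Real.exp (Real.log σ * N) = σ ^ N := by rw [mul_comm, Real.exp_nat_mul, Real.exp_log hσ]
  have e2 : Real.exp (3 * Real.log g * N) = g ^ (3 * N) := by
    rw [show (3 : ℝ) * Real.log g * N = ((3 * N : ℕ) : ℝ) * Real.log g by push_cast; ring, Real.exp_nat_mul, Real.exp_log hg]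
  have h : Real.exp E * (σ ^ N * g ^ (3 * N) * Z * I)
      = Real.exp E * (Real.exp (Real.log σ * N) * Real.exp (3 * Real.log g * N) * Real.exp (Real.log Z) * Real.exp (Real.log I)) := by
    rw [e1, e2, Real.exp_log hZ, Real.exp_log hI]
  rw [h, ← Real.exp_add, ← Real.exp_add, ← Real.exp_add, ← Real.exp_add]
  congr 1; ring

/-! ## §2 The lower row from the pins -/

/-- **R3D-02χ AT EVERY LEVEL, MODULO PRINT'S (55) DATA PINS AND THE TWO k = 0-SHAPED ROWS** — the `k ≥ 1` twin of the lower half of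
`FibreZeroSU2.fibre_pair_zero_of_pins`: for `G = SU(2)`, the lane's axial averaging at level `k` (standing range), the transport data of the upper
file, a measurable gauge-invariant validity family `lo k`, the rows `hdom` (small-field window ⊆ `lo k`) and `hpos` (`∫Ψ > 0` on `lo (k+1)`), and the
pins `hσ`∕`hdg`∕`hZU`∕`hFl` (IDENTICAL to the upper row's): `PinnedStep.Fibre57LowOnAC 𝔎 X 𝔖 lo k` HOLDS.
[cite: Balaban1985UV3, (37) p.265 + (47) p.267 + (55)–(58) pp.269–270 + p.272 L32–33] -/
theorem fibre57LowOnAC_of_pins (lo : (k : ℕ) → Set (GaugeField S.P k SU2)) (k : ℕ) [DecidableEq (PBond S.P k)] (hk : k + 1 ≤ S.P.m + S.P.K)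
    (hav : (X.av k).avg = axialAvg)
    (U₁ : GaugeField S.P (k + 1) SU2 → GaugeField S.P k SU2) (hax : ∀ V, ∀ b ∈ forest S.P k, U₁ V b = 1)
    (hfib : ∀ V, axialAvg (U₁ V) = V) (hbg : ∀ V, X.Uk k V = ukAll X.Uk k (U₁ V))
    (q : GaugeField S.P (k + 1) SU2 → (Free S.P k → E3) → ℝ) (hqm : ∀ V, Measurable (q V))
    (hZ : ∀ V, 0 < partZ (volume : Measure (Free S.P k → E3)) (q V))
    (hU : Measurable (X.UkH k (Hist.triv S.P k))) (hPm : Measurable ((inputOfAC 𝔎 X 𝔖).Pint k (Hist.triv S.P k)))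
    (cP : ℝ) (hPb : ∀ U, (inputOfAC 𝔎 X 𝔖).Pint k (Hist.triv S.P k) U ≤ cP)
    (hinv : GaugeInvariant (fun U : GaugeField S.P k SU2 =>
      Real.exp (-((towerOfAC 𝔎 X 𝔖).mainT k (Hist.triv S.P k) U) + (towerOfAC 𝔎 X 𝔖).Pint k (Hist.triv S.P k) U)))
    (hlom : MeasurableSet (lo k)) (hloinv : ∀ (u : GaugeTransf S.P k SU2) (U : GaugeField S.P k SU2), gaugeAct u U ∈ lo k ↔ U ∈ lo k)
    (hdom : ∀ U : GaugeField S.P k SU2,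
      chiB 𝔎.carrier.M₁ (rcolOf S 𝔎.carrier) (eps1Of S 𝔎.carrier) k (Hist.triv S.P (k + 1)) U ≠ 0 → U ∈ lo k)
    (hσ : (piecesAC 𝔎 X 𝔖 k).logσ₀ = Real.log sigma0) (hdg : (piecesAC 𝔎 X 𝔖 k).dg = 3)
    (hZU : ∀ V, (piecesAC 𝔎 X 𝔖 k).logZU (Hist.triv S.P (k + 1)) V = Real.log (partZ (volume : Measure (Free S.P k → E3)) (q V)))
    (hFl : ∀ V, (piecesAC 𝔎 X 𝔖 k).logFl (Hist.triv S.P (k + 1)) V =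
      Real.log (∫ A, (Set.univ.pi fun _ : Free S.P k => ball (0 : E3) Real.pi).indicator (fun _ => (1 : ℝ)) (S.gk k • A) *
              chiB 𝔎.carrier.M₁ (rcolOf S 𝔎.carrier) (eps1Of S 𝔎.carrier) k (Hist.triv S.P (k + 1)) (fieldAt U₁ (S.gk k) V A) *
              (∏ i, expWeight ((S.gk k • A) i) / sigma0) *
              Real.exp (-((towerOfAC 𝔎 X 𝔖).mainT k (Hist.triv S.P k) (fieldAt U₁ (S.gk k) V A)
                  - (towerOfAC 𝔎 X 𝔖).mainT (k + 1) (Hist.triv S.P (k + 1)) V)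
                + ((towerOfAC 𝔎 X 𝔖).Pint k (Hist.triv S.P k) (fieldAt U₁ (S.gk k) V A) - (piecesAC 𝔎 X 𝔖 k).Pold (Hist.triv S.P (k + 1)) V)
                + q V A)
            ∂(normalized (volume : Measure (Free S.P k → E3)) (q V))))
    (hpos : ∀ V, V ∈ lo (k + 1) →
      0 < ∫ A, (Set.univ.pi fun _ : Free S.P k => ball (0 : E3) Real.pi).indicator (fun _ => (1 : ℝ)) (S.gk k • A) *
              chiB 𝔎.carrier.M₁ (rcolOf S 𝔎.carrier) (eps1Of S 𝔎.carrier) k (Hist.triv S.P (k + 1)) (fieldAt U₁ (S.gk k) V A) *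
              (∏ i, expWeight ((S.gk k • A) i) / sigma0) *
              Real.exp (-((towerOfAC 𝔎 X 𝔖).mainT k (Hist.triv S.P k) (fieldAt U₁ (S.gk k) V A)
                  - (towerOfAC 𝔎 X 𝔖).mainT (k + 1) (Hist.triv S.P (k + 1)) V)
                + ((towerOfAC 𝔎 X 𝔖).Pint k (Hist.triv S.P k) (fieldAt U₁ (S.gk k) V A) - (piecesAC 𝔎 X 𝔖 k).Pold (Hist.triv S.P (k + 1)) V)
                + q V A)
            ∂(normalized (volume : Measure (Free S.P k → E3)) (q V))) :
    Fibre57LowOnAC 𝔎 X 𝔖 lo k := by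
  classical
  set χ₀ : GaugeField S.P k SU2 → ℝ :=
    chiB 𝔎.carrier.M₁ (rcolOf S 𝔎.carrier) (eps1Of S 𝔎.carrier) k (Hist.triv S.P (k + 1)) with hχ₀
  set φ : GaugeField S.P k SU2 → ℝ := (lo k).indicator (fun _ => (1 : ℝ)) with hφ
  set c : ℝ := -(towerOfAC 𝔎 X 𝔖).Ecst k - (towerOfAC 𝔎 X 𝔖).Rm k with hc
  have hφm : Measurable φ := (measurable_const.indicator hlom)
  have hφ0 : ∀ U, 0 ≤ φ U := fun U => Set.indicator_nonneg (fun _ _ => zero_le_one) U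
  have hφ1 : ∀ U, φ U ≤ 1 := fun U => Set.indicator_le_self' (fun _ _ => zero_le_one) U
  have hφinv : GaugeInvariant φ := fun u U => by
    rw [hφ]
    by_cases hU : U ∈ lo k
    · rw [Set.indicator_of_mem hU, Set.indicator_of_mem ((hloinv u U).2 hU)]
    · rw [Set.indicator_of_notMem hU, Set.indicator_of_notMem (fun h => hU ((hloinv u U).1 h))]
  have hχm : Measurable χ₀ := measurable_chiB _ _ _ k _
  -- the row's integrand, in the general form
  have hint : (fun U : GaugeField S.P k SU2 => φ U *
      Real.exp (-((towerOfAC 𝔎 X 𝔖).mainT k (Hist.triv S.P k) U) + (towerOfAC 𝔎 X 𝔖).Pint k (Hist.triv S.P k) U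
        - (towerOfAC 𝔎 X 𝔖).Ecst k - (towerOfAC 𝔎 X 𝔖).Rm k))
      = fun U => φ U *
      Real.exp (-((towerOfAC 𝔎 X 𝔖).mainT k (Hist.triv S.P k) U) + (towerOfAC 𝔎 X 𝔖).Pint k (Hist.triv S.P k) U + c) := by
    funext U; congr 2; rw [hc]; ring
  have hT := transport_triv_ae_eq_fluct_gen 𝔎 X 𝔖 k hk hav U₁ hax hfib hU hPm cP hPb hinv φ hφm hφ0 hφ1 hφinv c
  have hg : 0 < S.gk k := gk_pos S k
  have hgk : (towerOfAC 𝔎 X 𝔖).g k = S.gk k := rfl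
  have hstar := starB_piecesAC_triv 𝔎 X 𝔖 k hk
  -- measurability of the fluctuation map `W ↦ fluct W · U₁ V`
  have hfluct : Measurable fun W : GaugeField S.P k SU2 => (fluct W : GaugeField S.P k SU2) := by
    refine measurable_pi_iff.mpr fun b => ?_
    unfold fluct axGlue
    exact (measurable_pi_apply b).comp ((measurable_crossParam hk).comp
      (measurable_const.prodMk (T4TreeGaugeFixing.measurable_fixTo _ _)))
  have hmain : ∀ U, (towerOfAC 𝔎 X 𝔖).mainT k (Hist.triv S.P k) U = (S.gk k)⁻¹ ^ 2 * S.actionEta k (X.UkH k (Hist.triv S.P k) U) := fun _ => rfl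
  have hPt : ∀ U, (towerOfAC 𝔎 X 𝔖).Pint k (Hist.triv S.P k) U = (inputOfAC 𝔎 X 𝔖).Pint k (Hist.triv S.P k) U := fun _ => rfl
  have hexpm : Measurable fun U : GaugeField S.P k SU2 =>
      -((towerOfAC 𝔎 X 𝔖).mainT k (Hist.triv S.P k) U) + (towerOfAC 𝔎 X 𝔖).Pint k (Hist.triv S.P k) U + c := by
    simp_rw [hmain, hPt]
    exact ((measurable_const.mul ((Bound55Std.measurable_actionEta (S := S) k).comp hU)).neg.add hPm).add measurable_const
  have hexpb : ∀ U : GaugeField S.P k SU2,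
      Real.exp (-((towerOfAC 𝔎 X 𝔖).mainT k (Hist.triv S.P k) U) + (towerOfAC 𝔎 X 𝔖).Pint k (Hist.triv S.P k) U + c) ≤ Real.exp (cP + c) :=
    fun U => Real.exp_le_exp.mpr (by
      have h0 := mainT_nonneg 𝔎 X 𝔖 k (Hist.triv S.P k) U; have h1 := hPb U; rw [hPt]; linarith)
  unfold Fibre57LowOnAC
  rw [hint]
  refine Filter.EventuallyLE.trans ?_ hT.symm.le
  filter_upwards with V
  have hFW : Measurable fun W : GaugeField S.P k SU2 => (fun b => fluct W b * U₁ V b : GaugeField S.P k SU2) :=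
    measurable_pi_iff.mpr fun b => ((measurable_pi_apply b).comp hfluct).mul measurable_const
  by_cases hV : V ∈ lo (k + 1)
  · rw [Set.indicator_of_mem hV, one_mul, hσ, hdg, hgk, hstar, hZU V, hFl V]
    -- the left side is the `χB`-cut fluctuation integral (pins + `hpos`), which is below the `lo k`-cut one (`hdom`)
    have hχW := fluct_integral_triv_eq_gen 𝔎 X 𝔖 k hk U₁ hbg q hU hPm cP hPb χ₀ hχm (fun U => chiB_nonneg _ _ _ k _ U)
      (fun U => chiB_le_one _ _ _ k _ U) c V (hqm V) (hZ V)
    have hmono : ∫ W, χ₀ (fun b => fluct W b * U₁ V b) *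
          Real.exp (-((towerOfAC 𝔎 X 𝔖).mainT k (Hist.triv S.P k) (fun b => fluct W b * U₁ V b))
            + (towerOfAC 𝔎 X 𝔖).Pint k (Hist.triv S.P k) (fun b => fluct W b * U₁ V b) + c) ∂(fieldMeasure S.P k SU2)
        ≤ ∫ W, φ (fun b => fluct W b * U₁ V b) *
          Real.exp (-((towerOfAC 𝔎 X 𝔖).mainT k (Hist.triv S.P k) (fun b => fluct W b * U₁ V b))
            + (towerOfAC 𝔎 X 𝔖).Pint k (Hist.triv S.P k) (fun b => fluct W b * U₁ V b) + c) ∂(fieldMeasure S.P k SU2) := by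
      refine integral_mono (AveragingRT.integrable_of_abs_le ((hχm.comp hFW).mul (Real.measurable_exp.comp (hexpm.comp hFW)))
          (Real.exp (cP + c)) (fun W => ?_)) (AveragingRT.integrable_of_abs_le ((hφm.comp hFW).mul
          (Real.measurable_exp.comp (hexpm.comp hFW))) (Real.exp (cP + c)) (fun W => ?_)) (fun W => ?_)
      · rw [abs_mul, Real.abs_exp, abs_of_nonneg (chiB_nonneg _ _ _ k _ _)]
        exact (mul_le_mul (chiB_le_one _ _ _ k _ _) (hexpb _) (Real.exp_pos _).le zero_le_one).trans_eq (one_mul _)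
      · rw [abs_mul, Real.abs_exp, abs_of_nonneg (hφ0 _)]
        exact (mul_le_mul (hφ1 _) (hexpb _) (Real.exp_pos _).le zero_le_one).trans_eq (one_mul _)
      · refine mul_le_mul_of_nonneg_right ?_ (Real.exp_pos _).le
        by_cases h0 : χ₀ (fun b => fluct W b * U₁ V b) = 0
        · rw [h0]; exact hφ0 _
        · rw [hφ, Set.indicator_of_mem (hdom _ h0)]; exact chiB_le_one _ _ _ k _ _
    refine le_trans (le_of_eq ?_) (hχW.symm.le.trans hmono)
    rw [← exp_mul_eq_exp_log_pins _ _ _ _ _ _ sigma0_pos hg (hZ V) (hpos V hV)]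
    congr 1; rw [hc]; ring
  · rw [Set.indicator_of_notMem hV, zero_mul]
    exact integral_nonneg fun W => mul_nonneg (hφ0 _) (Real.exp_pos _).le

end Summit.QuantumFields.YangMills.Theorems.PinnedStepTrivPins

end
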